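import Summits.CriticalPhenomena.PercolationContinuityZ3.Theorems.PercNearOneGluingNoHeavyQuantDepthTwoRelayRow
import Summits.CriticalPhenomena.PercolationContinuityZ3.Theorems.PercNearOneGluingNoHeavyQuantDepthTwoRelayRowZero
import Summits.CriticalPhenomena.PercolationContinuityZ3.Theorems.PercNearOneGluingNoHeavyQuantDepthTwoRelayTilt
import Summits.CriticalPhenomena.PercolationContinuityZ3.Theorems.PercNearOneGluingNoHeavyQuantDepthTwoRelayNewTop
import HarnessLib

/-!
# QUANT lane R8, depth-2 closure (D2) in the RELAY case: ASSEMBLY — `LawDec.TLC` of (relay_g) ∗ μ at target `T + g` from the depth-2 class of μ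
# (G₁ = `LawDec.TLC2GateConvTLC` in the relay case, q = 1, as a theorem)

builds on p205010 (kernel theorem, internal audit signed; external expert review pending)

Support file (`--supports stmt-CriticalPhenomena-4575`), QUANT lane seat prim-quant-arm-2 (gen 39), rung R8 of
`run/shared/lean/prim/quant/LADDER.md`; lane pointer `run/shared/lean/prim/quant/FOR-PROVERS-D2-RELAY.md`.  One theorem, standard axioms, no sorries.

THE THEOREM (`relayConv_tlc_of_depthTwo`).  `0 < y < 1`, `y ≤ g ≤ 1`; `μ ≥ 0` a law on `{0..M}` of mass `1` and mean `T`, top-affordable (`y·M ≤ T`),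
satisfying the depth-≤1 family `LawDec.TLC y T M μ` and the depth-2 family `LawDec.TLC2 y T M μ` (census-2 g64; both follow from DEC at every layer,
`tlc_of_decAt_all` / `tlc2_of_decAt_all`).  Then the relay product `ν = lconv M 1 μ {0: 1−g, 1: g}` satisfies `LawDec.TLC y (T + g) (M + 1) ν` — EVERY
top-low-capacity row of the product.  This is the conjecture G₁ (`LawDec.TLC2GateConvTLC`, `…QuantDepthTwoClosure`) in the case `q = 1`, `M₂ = 1`
(partner a relay of gate `g ≥ y`); with `twoLayerRow_of_tlc` (`…QuantDepthOneRows`, `T + g ≤ M + 1`) the product's two-layer bounds follow too, so of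
D2's three product families only `TLC2` of the product remains in the relay case.

THE ROW LIST (product layer `j ≤ M`, threshold `i ≤ j`, `2i < T + g`):
* `i = 0`, layer case of the one-row lemma: census-2 g67's `relayConv_tlcRowZero_of_tlc` (`…QuantDepthTwoRelayRowZero`; ONE scaled factor row);
* `1 ≤ i`, `2i < T`, layer case: census-2 g67's `relayConv_tlcRow_of_tlc2` (`…QuantDepthTwoRelayRow`; ONE factor two-threshold row `(j*, i−1, i, θ₀)`);
* `1 ≤ i`, `T ≤ 2i` (the new top low), layer case: `relayConv_tlcRowNewTop_functional` (`…QuantDepthTwoRelayNewTop`, this seat; ONE factor row `(j*, i−1)`);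
* otherwise `j = M` with a non-cheap top pair: the tilt `relayConv_tlcRowTop_functional` (`…QuantDepthTwoRelayTilt`, this seat; the mean).
The "layer case" `(j < M ∧ (T+g < i+j → u ≤ usage′)) ∨ (T+g < i+j ∧ usage′ ≤ u)` holds automatically for `j < M`; its failure forces `j = M` and
`T + g < i + M → u < usage′`, the tilt lemma's hypothesis.  HONEST STATUS: G₁ is a theorem in the relay case at `q = 1`; G₁ in general, D2 (the
product's `TLC2` rows; gated `q < 1`; partners with `M₂ ≥ 2`), SGC and `Quant.FarTreeRow` (light) remain OPEN; nothing here is cited as a published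
result; the lane's RATE class log\* and honest sentence (`run/shared/lean/prim/quant/README.md`) are unchanged.

[this work]; the one-row lemma: prim-quant-census-2 g67; depth-≤2 families and G₁: prim-quant-census-2 g64; lead rulings V364/V373 (this lane).  The gluing
rows served [cite: KozmaNitzan2024, Conjecture 3 (p. 15)]; product measure [cite: Grimmett1999, §1.3 p. 10].
-/

noncomputable section

namespace Summit.CriticalPhenomena.PercolationContinuityZ3.Theorems

namespace Quant

open Finset

namespace LawDec

/-! ### ASSEMBLY: TLC of the relay product from the depth-2 class of the factor (G₁ in the relay case, q = 1) -/

/-- **G₁ IN THE RELAY CASE (q = 1): the gated-relay product of a depth-2 law satisfies every top-low-capacity row.**  `0 < y < 1`, `y ≤ g ≤ 1`;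
`μ ≥ 0` on `{0..M}` of mass `1` and mean `T`, top-affordable (`y·M ≤ T`), with `TLC y T M μ` and `TLC2 y T M μ` (census-2 g64's depth-≤2 rows;
both follow from DEC at every layer).  Then `ν = lconv M 1 μ {0: 1−g, 1: g}` satisfies `TLC y (T + g) (M + 1) ν`.  Rows `(j, 0)`: census-2 g67's
`relayConv_tlcRowZero_of_tlc`; old thresholds `2i < T`: `relayConv_tlcRow_of_tlc2`; the new top low `T ≤ 2i`: `relayConv_tlcRowNewTop_functional`;
the top layer with a non-cheap top pair: the tilt `relayConv_tlcRowTop_functional`. [this work] -/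
theorem relayConv_tlc_of_depthTwo (y T g : ℝ) (M : ℕ) (μ : ℕ → ℝ)
    (hy0 : 0 < y) (hy1 : y < 1) (hyg : y ≤ g) (hg1 : g ≤ 1) (hμ0 : ∀ h, 0 ≤ μ h)
    (hμ1 : ∑ h ∈ Finset.range (M + 1), μ h = 1) (hμT : ∑ h ∈ Finset.range (M + 1), (h : ℝ) * μ h = T)
    (hTA : y * (M : ℝ) ≤ T) (hT1 : TLC y T M μ) (hT2 : TLC2 y T M μ) :
    TLC y (T + g) (M + 1) (lconv M 1 μ (fun h => if h = 1 then g else if h = 0 then 1 - g else 0)) := by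
  intro j i hj hij hlow
  have hjM : j ≤ M := by omega
  have hM0 : (0 : ℝ) ≤ M := Nat.cast_nonneg M
  by_cases hcase : (j < M ∧ (T + g < (i : ℝ) + j → y / (1 - y) ≤ usage y (T + g) j i j))
      ∨ (T + g < (i : ℝ) + j ∧ usage y (T + g) j i j ≤ y / (1 - y))
  · -- the one-row lemmas
    have hM1 : 1 ≤ M := by
      rcases hcase with ⟨hjM', _⟩ | ⟨hc, _⟩
      · omega
      · by_contra h0
        have hM : M = 0 := by omega
        have hj0 : j = 0 := by omega
        rw [hj0] at hc; push_cast at hc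
        have : (0 : ℝ) ≤ i := Nat.cast_nonneg i
        linarith [lt_of_lt_of_le hy0 hyg, mul_nonneg hy0.le hM0]
    have hTpos : 0 < T := by
      have : (1 : ℝ) ≤ M := by exact_mod_cast hM1
      nlinarith
    rcases Nat.eq_zero_or_pos i with hi0 | hipos
    · subst hi0
      have hcase' : (j < M ∧ (T + g < (j : ℝ) → y / (1 - y) ≤ usage y (T + g) j 0 j))
          ∨ (T + g < (j : ℝ) ∧ usage y (T + g) j 0 j ≤ y / (1 - y)) := by
        simpa using hcase
      exact relayConv_tlcRowZero_of_tlc y T g M j μ hy0 hy1 hyg hg1 hμ0 hT1 hTpos hjM hcase'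
    · by_cases htop : T ≤ 2 * (i : ℝ)
      · -- the new top low
        obtain ⟨k, rfl⟩ : ∃ k, i = k + 1 := ⟨i - 1, by omega⟩
        have htop' : T ≤ 2 * ((k : ℝ) + 1) := by push_cast at htop; exact htop
        have hlow' : 2 * ((k : ℝ) + 1) < T + g := by push_cast at hlow; exact hlow
        exact tlcRow_of_functional y (T + g) (M + 1) (k + 1) j _ hij (by omega)
          (relayConv_tlcRowNewTop_functional y T g M k j μ hy0 hy1 hyg hg1 hμ0 hT1 htop' hlow' hij hjM hcase)
      · exact relayConv_tlcRow_of_tlc2 y T g M i j μ hy0 hy1 hyg hg1 hμ0 hT2 hipos hij hjM (not_le.1 htop) hcase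
  · -- the top layer with a non-cheap top pair: the tilt
    have hjM' : j = M := by
      by_contra hne
      have hjM'' : j < M := by omega
      apply hcase
      by_cases hc : T + g < (i : ℝ) + j
      · by_cases hle : y / (1 - y) ≤ usage y (T + g) j i j
        · exact Or.inl ⟨hjM'', fun _ => hle⟩
        · exact Or.inr ⟨hc, (not_le.1 hle).le⟩
      · exact Or.inl ⟨hjM'', fun h => absurd h hc⟩
    subst hjM'
    have hnc : T + g < (i : ℝ) + j → y / (1 - y) < usage y (T + g) j i j := by
      intro hc
      by_contra hle
      exact hcase (Or.inr ⟨hc, not_lt.1 hle⟩)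
    exact tlcRow_of_functional y (T + g) (j + 1) i j _ hij (by omega)
      (relayConv_tlcRowTop_functional y T g j i μ hy0 hy1 hyg hg1 hμ0 hμ1 hμT hTA hij hlow hnc)


end LawDec

end Quant

end Summit.CriticalPhenomena.PercolationContinuityZ3.Theorems
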